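import Summits.Ventures.CertifiedArithmetic.LowPrec.GemmThetaE3M2Defs

/-!
# The θ-certificate of E3M2²→bfloat16: kernel check of the states with index in `[1344, 1440)`

HONEST FRAMING (venture CertifiedArithmetic / cell `pub-lowprec`, seat gemm, gen 7): certified error
envelopes and provably optimal rounding/accumulation schemes for low-precision formats under stated
cost models; every table by two implementations; no hardware or vendor claims.

Part 15 of 27 of the kernel check of the Boolean certificate of `GemmThetaE3M2Defs.lean`
(paper `gemm.tex` §Regimes Prop. Θ(i), configuration E3M2·E3M2 → `bfloat16`, sequential, RNE): every
edge from the states with index `1344 ≤ i < 1440` (both signs, all 291 letters, with the pair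
checks after free moves) passes `edgeOK`, by `decide +kernel` in chunks of 24 indices (each chunk
≈ 13,968 edges).  Split into files only to keep each file's kernel time near three minutes;
`GemmThetaE3M2.lean` assembles the parts.  See the Defs file for the meaning of the check.
-/

namespace Literature.ComputerArithmetic.FloatingPoint

namespace MiniFloat

namespace ThetaE3M2

/-- Every edge from the states with index in `[1344, 1368)` (both signs, all 291 letters) passes
`edgeOK`. [cell certificate, kernel-checked] -/
theorem edges_ok_1344 : rowsOK 1344 24 = true := by
  decide +kernel

/-- Every edge from the states with index in `[1368, 1392)` (both signs, all 291 letters) passes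
`edgeOK`. [cell certificate, kernel-checked] -/
theorem edges_ok_1368 : rowsOK 1368 24 = true := by
  decide +kernel

/-- Every edge from the states with index in `[1392, 1416)` (both signs, all 291 letters) passes
`edgeOK`. [cell certificate, kernel-checked] -/
theorem edges_ok_1392 : rowsOK 1392 24 = true := by
  decide +kernel

/-- Every edge from the states with index in `[1416, 1440)` (both signs, all 291 letters) passes
`edgeOK`. [cell certificate, kernel-checked] -/
theorem edges_ok_1416 : rowsOK 1416 24 = true := by
  decide +kernel

/-- PART 15: every edge from the states with index in `[1344, 1440)` passes `edgeOK`.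
[cell certificate, kernel-checked] -/
theorem part_15 : rowsOK 1344 96 = true :=
  rowsOK_append (l₁ := 24) (l₂ := 72) edges_ok_1344 <|
  rowsOK_append (l₁ := 24) (l₂ := 48) edges_ok_1368 <|
  rowsOK_append (l₁ := 24) (l₂ := 24) edges_ok_1392 <|
  edges_ok_1416

end ThetaE3M2

end MiniFloat

end Literature.ComputerArithmetic.FloatingPoint
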